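import Mathlib.Analysis.SpecialFunctions.ExpDeriv
import Mathlib.Analysis.SpecialFunctions.Log.Basic
import Mathlib.Analysis.Calculus.Deriv.Slope
import Literature.Analysis.FluidPDE.CompressibleEulerImplosionUniqueness
import HarnessLib

/-!
# Buckmaster–Cao-Labora–Gómez-Serrano at `γ = 5/3`: from a profile at `ζ = 0` to a trajectory of (1.8) near `ξ = −∞`

Topic `Literature/Analysis/FluidPDE`; namespace
`Literature.Analysis.FluidPDE.BuckmasterCaolaboraGomezserrano2025.Monatomic`. Companion of
`CompressibleEulerImplosion.lean` (named fact `BuckmasterCaolaboraGomezserrano2025_thm11_monatomic`,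
THEOREM 1.1 of T. Buckmaster, G. Cao-Labora, J. Gómez-Serrano, *Smooth imploding solutions for 3D
compressible fluids*, Forum Math. Pi 13 (2025) e6, arXiv:2208.09445, at `γ = 5/3`, `α = 1/3`);
converse companion of `CompressibleEulerImplosionCoords.lean` (which goes from (1.8) to (1.10)).

Brick D2-entry of the discharge plan — the opening lines of the second part of Proposition 2.5:
a profile `𝒲` solving the self-similar equation (1.10) near `ζ = 0` (e.g. the origin series of
Prop. 2.5, first part, with `𝒲(0) = A > 0`, `𝒲′(0) = w₁ = 1 − r`) defines through
`W(ξ) = e^{−ξ} 𝒲(e^ξ)`, `Z(ξ) = −e^{−ξ} 𝒲(−e^ξ)` (eq. (2.13), `ζ = e^ξ`) a solution of (1.8)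
for `ξ` near `−∞` (`DW_mul_deriv_WofProfile`, `DZ_mul_deriv_ZofProfile`,
`hasDerivAt_WZofProfile`), with `W → +∞`, `Z → −∞`, `W + Z → 2𝒲′(0)` as `ξ → −∞`
(`tendsto_WofProfile_atBot`, `tendsto_ZofProfile_atBot`, `tendsto_W_add_Z_atBot`); consequently,
for `1 < r < r*`, it is eventually off both sonic lines (`D_W > 0 > D_Z`) and inside the triangle
`𝒯^{(H)}` of Prop. 2.5 with `H = W − W₀` ("`W + Z = 2w₁ + O(ζ) = −4(r−1)/(3(γ−1))`, so for `ζ > 0`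
sufficiently small and `H` sufficiently large `(W, Z)` lies in `𝒯^{(H)}`": `eventually_entry`).
Two real definitions with bodies (`WofProfile`, `ZofProfile`), theorems otherwise.
[cite: BuckmasterCaolaboraGomezserrano2025, Prop. 2.5 (proof), eqs. (1.8), (1.10), (2.13)]
-/

noncomputable section

open Set Filter Topology

namespace Literature.Analysis.FluidPDE

namespace BuckmasterCaolaboraGomezserrano2025

namespace Monatomic

variable {r : ℝ}

/-- `W(ξ) = e^{−ξ} 𝒲(e^ξ)` (eq. (2.13) with `ζ = e^ξ`). [cite: BuckmasterCaolaboraGomezserrano2025, eq. (2.13)] -/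
def WofProfile (𝒲 : ℝ → ℝ) (ξ : ℝ) : ℝ := Real.exp (-ξ) * 𝒲 (Real.exp ξ)

/-- `Z(ξ) = −e^{−ξ} 𝒲(−e^ξ)` (eq. (2.13): `𝒵(ζ) = −𝒲(−ζ)`, `ζ = e^ξ`).
[cite: BuckmasterCaolaboraGomezserrano2025, eq. (2.13)] -/
def ZofProfile (𝒲 : ℝ → ℝ) (ξ : ℝ) : ℝ := -Real.exp (-ξ) * 𝒲 (-Real.exp ξ)

/-- [folklore] -/
theorem WofProfile_def (𝒲 : ℝ → ℝ) (ξ : ℝ) : WofProfile 𝒲 ξ = Real.exp (-ξ) * 𝒲 (Real.exp ξ) := rfl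

/-- [folklore] -/
theorem ZofProfile_def (𝒲 : ℝ → ℝ) (ξ : ℝ) : ZofProfile 𝒲 ξ = -Real.exp (-ξ) * 𝒲 (-Real.exp ξ) := rfl

/-- `𝒲(ζ) = ζ W(log ζ)`-type inversion: `𝒲(e^ξ) = e^ξ W(ξ)`, `𝒲(−e^ξ) = −e^ξ Z(ξ)`. [folklore] -/
theorem profile_exp_eq (𝒲 : ℝ → ℝ) (ξ : ℝ) :
    𝒲 (Real.exp ξ) = Real.exp ξ * WofProfile 𝒲 ξ ∧
    𝒲 (-Real.exp ξ) = -Real.exp ξ * ZofProfile 𝒲 ξ := by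
  have h : Real.exp ξ * Real.exp (-ξ) = 1 := by rw [← Real.exp_add]; simp
  refine ⟨?_, ?_⟩
  · unfold WofProfile
    calc 𝒲 (Real.exp ξ) = (Real.exp ξ * Real.exp (-ξ)) * 𝒲 (Real.exp ξ) := by rw [h, one_mul]
      _ = _ := by ring
  · unfold ZofProfile
    calc 𝒲 (-Real.exp ξ) = (Real.exp ξ * Real.exp (-ξ)) * 𝒲 (-Real.exp ξ) := by rw [h, one_mul]
      _ = _ := by ring

/-! ### Chain rule -/

/-- `W′(ξ) = 𝒲′(e^ξ) − W(ξ)`. [folklore] -/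
theorem hasDerivAt_WofProfile {𝒲 : ℝ → ℝ} {D ξ : ℝ} (h𝒲 : HasDerivAt 𝒲 D (Real.exp ξ)) :
    HasDerivAt (WofProfile 𝒲) (D - WofProfile 𝒲 ξ) ξ := by
  have h1 : HasDerivAt (fun x => 𝒲 (Real.exp x)) (D * Real.exp ξ) ξ :=
    h𝒲.comp ξ (Real.hasDerivAt_exp ξ)
  have h2 : HasDerivAt (fun x => Real.exp (-x)) (Real.exp (-ξ) * -1) ξ :=
    (Real.hasDerivAt_exp (-ξ)).comp ξ (hasDerivAt_neg ξ)
  have h3 := h2.mul h1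
  have e : Real.exp (-ξ) * Real.exp ξ = 1 := by rw [← Real.exp_add]; simp
  refine h3.congr_deriv ?_
  unfold WofProfile
  linear_combination D * e

/-- `Z′(ξ) = 𝒲′(−e^ξ) − Z(ξ)`. [folklore] -/
theorem hasDerivAt_ZofProfile {𝒲 : ℝ → ℝ} {D ξ : ℝ} (h𝒲 : HasDerivAt 𝒲 D (-Real.exp ξ)) :
    HasDerivAt (ZofProfile 𝒲) (D - ZofProfile 𝒲 ξ) ξ := by
  have h1 : HasDerivAt (fun x => 𝒲 (-Real.exp x)) (D * -Real.exp ξ) ξ :=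
    h𝒲.comp ξ (Real.hasDerivAt_exp ξ).neg
  have h2 : HasDerivAt (fun x => -Real.exp (-x)) (-(Real.exp (-ξ) * -1)) ξ :=
    ((Real.hasDerivAt_exp (-ξ)).comp ξ (hasDerivAt_neg ξ)).neg
  have h3 := h2.mul h1
  have e : Real.exp (-ξ) * Real.exp ξ = 1 := by rw [← Real.exp_add]; simp
  refine h3.congr_deriv ?_
  unfold ZofProfile
  linear_combination D * e

/-! ### The algebra: (1.10) at `±ζ` is (1.8) -/

/-- From (1.10) at `ζ > 0`: `D_W (𝒲′(ζ) − W) = N_W` where `𝒲(ζ) = ζ W`, `𝒲(−ζ) = −ζ Z`.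
[cite: BuckmasterCaolaboraGomezserrano2025, eqs. (1.8), (1.10), (2.13)] -/
theorem DW_mul_of_profile_eq {ζ W Z D : ℝ} (hζ : 0 < ζ)
    (h : (r - 1) * (ζ * W)
      + (ζ + 1 / 2 * (ζ * W - -ζ * Z + 1 / 3 * (ζ * W + -ζ * Z))) * D
      + 1 / 3 / (2 * ζ) * ((ζ * W) ^ 2 - (-ζ * Z) ^ 2) = 0) :
    DW W Z * (D - W) = NW r W Z := by
  have hζ0 : ζ ≠ 0 := hζ.ne'
  have key : 6 * ζ ^ 2 * (DW W Z * (D - W) - NW r W Z)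
      = 6 * ζ * ((r - 1) * (ζ * W)
        + (ζ + 1 / 2 * (ζ * W - -ζ * Z + 1 / 3 * (ζ * W + -ζ * Z))) * D
        + 1 / 3 / (2 * ζ) * ((ζ * W) ^ 2 - (-ζ * Z) ^ 2)) := by
    unfold DW NW
    field_simp
    ring
  rw [h, mul_zero] at key
  have h6 : (6 * ζ ^ 2) ≠ 0 := by positivity
  have := (mul_eq_zero.mp key).resolve_left h6
  linarith

/-- From (1.10) at `−ζ < 0`: `D_Z (𝒲′(−ζ) − Z) = N_Z`. [cite: BuckmasterCaolaboraGomezserrano2025, eqs. (1.8), (1.10), (2.13)] -/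
theorem DZ_mul_of_profile_eq {ζ W Z D : ℝ} (hζ : 0 < ζ)
    (h : (r - 1) * (-ζ * Z)
      + (-ζ + 1 / 2 * (-ζ * Z - ζ * W + 1 / 3 * (-ζ * Z + ζ * W))) * D
      + 1 / 3 / (2 * -ζ) * ((-ζ * Z) ^ 2 - (ζ * W) ^ 2) = 0) :
    DZ W Z * (D - Z) = NZ r W Z := by
  have hζ0 : ζ ≠ 0 := hζ.ne'
  have key : 6 * ζ ^ 2 * (DZ W Z * (D - Z) - NZ r W Z)
      = -(6 * ζ) * ((r - 1) * (-ζ * Z)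
        + (-ζ + 1 / 2 * (-ζ * Z - ζ * W + 1 / 3 * (-ζ * Z + ζ * W))) * D
        + 1 / 3 / (2 * -ζ) * ((-ζ * Z) ^ 2 - (ζ * W) ^ 2)) := by
    unfold DZ NZ
    field_simp
    ring
  rw [h, mul_zero] at key
  have h6 : (6 * ζ ^ 2) ≠ 0 := by positivity
  have := (mul_eq_zero.mp key).resolve_left h6
  linarith

/-- **(1.10) ⇒ (1.8).** If `𝒲` is differentiable at `±e^ξ` and satisfies the profile equation (1.10)
at `ζ = e^ξ` and at `ζ = −e^ξ`, then `(W, Z) = (WofProfile 𝒲, ZofProfile 𝒲)` satisfies (1.8) at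
`ξ` in the multiplied form `D_W W′ = N_W`, `D_Z Z′ = N_Z`.
[cite: BuckmasterCaolaboraGomezserrano2025, eqs. (1.8)–(1.10), (2.13)] -/
theorem DW_mul_deriv_WofProfile {𝒲 : ℝ → ℝ} {ξ : ℝ}
    (hd : DifferentiableAt ℝ 𝒲 (Real.exp ξ))
    (heq : (r - 1) * 𝒲 (Real.exp ξ) + (Real.exp ξ + 1 / 2 * (𝒲 (Real.exp ξ) - 𝒲 (-Real.exp ξ)
        + 1 / 3 * (𝒲 (Real.exp ξ) + 𝒲 (-Real.exp ξ)))) * deriv 𝒲 (Real.exp ξ)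
      + 1 / 3 / (2 * Real.exp ξ) * (𝒲 (Real.exp ξ) ^ 2 - 𝒲 (-Real.exp ξ) ^ 2) = 0) :
    DW (WofProfile 𝒲 ξ) (ZofProfile 𝒲 ξ) * deriv (WofProfile 𝒲) ξ
      = NW r (WofProfile 𝒲 ξ) (ZofProfile 𝒲 ξ) := by
  rw [(hasDerivAt_WofProfile hd.hasDerivAt).deriv]
  obtain ⟨e1, e2⟩ := profile_exp_eq 𝒲 ξ
  rw [e1, e2] at heq
  exact DW_mul_of_profile_eq (Real.exp_pos ξ) heq

/-- The `Z`-half of **(1.10) ⇒ (1.8)**. [cite: BuckmasterCaolaboraGomezserrano2025, eqs. (1.8)–(1.10), (2.13)] -/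
theorem DZ_mul_deriv_ZofProfile {𝒲 : ℝ → ℝ} {ξ : ℝ}
    (hd : DifferentiableAt ℝ 𝒲 (-Real.exp ξ))
    (heq : (r - 1) * 𝒲 (-Real.exp ξ) + (-Real.exp ξ + 1 / 2 * (𝒲 (-Real.exp ξ) - 𝒲 (Real.exp ξ)
        + 1 / 3 * (𝒲 (-Real.exp ξ) + 𝒲 (Real.exp ξ)))) * deriv 𝒲 (-Real.exp ξ)
      + 1 / 3 / (2 * -Real.exp ξ) * (𝒲 (-Real.exp ξ) ^ 2 - 𝒲 (Real.exp ξ) ^ 2) = 0) :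
    DZ (WofProfile 𝒲 ξ) (ZofProfile 𝒲 ξ) * deriv (ZofProfile 𝒲) ξ
      = NZ r (WofProfile 𝒲 ξ) (ZofProfile 𝒲 ξ) := by
  rw [(hasDerivAt_ZofProfile hd.hasDerivAt).deriv]
  obtain ⟨e1, e2⟩ := profile_exp_eq 𝒲 ξ
  rw [e1, e2] at heq
  exact DZ_mul_of_profile_eq (Real.exp_pos ξ) heq

/-- The resolved form: off the sonic lines, `ξ ↦ (W, Z)(ξ)` solves `c′ = field r c`.
[cite: BuckmasterCaolaboraGomezserrano2025, eqs. (1.8)–(1.10)] -/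
theorem hasDerivAt_WZofProfile {𝒲 : ℝ → ℝ} {ξ : ℝ}
    (hd₁ : DifferentiableAt ℝ 𝒲 (Real.exp ξ)) (hd₂ : DifferentiableAt ℝ 𝒲 (-Real.exp ξ))
    (heq₁ : (r - 1) * 𝒲 (Real.exp ξ) + (Real.exp ξ + 1 / 2 * (𝒲 (Real.exp ξ) - 𝒲 (-Real.exp ξ)
        + 1 / 3 * (𝒲 (Real.exp ξ) + 𝒲 (-Real.exp ξ)))) * deriv 𝒲 (Real.exp ξ)
      + 1 / 3 / (2 * Real.exp ξ) * (𝒲 (Real.exp ξ) ^ 2 - 𝒲 (-Real.exp ξ) ^ 2) = 0)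
    (heq₂ : (r - 1) * 𝒲 (-Real.exp ξ) + (-Real.exp ξ + 1 / 2 * (𝒲 (-Real.exp ξ) - 𝒲 (Real.exp ξ)
        + 1 / 3 * (𝒲 (-Real.exp ξ) + 𝒲 (Real.exp ξ)))) * deriv 𝒲 (-Real.exp ξ)
      + 1 / 3 / (2 * -Real.exp ξ) * (𝒲 (-Real.exp ξ) ^ 2 - 𝒲 (Real.exp ξ) ^ 2) = 0)
    (hDW : DW (WofProfile 𝒲 ξ) (ZofProfile 𝒲 ξ) ≠ 0) (hDZ : DZ (WofProfile 𝒲 ξ) (ZofProfile 𝒲 ξ) ≠ 0) :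
    HasDerivAt (fun s => (WofProfile 𝒲 s, ZofProfile 𝒲 s))
      (field r (WofProfile 𝒲 ξ, ZofProfile 𝒲 ξ)) ξ := by
  have hW := hasDerivAt_WofProfile hd₁.hasDerivAt
  have hZ := hasDerivAt_ZofProfile hd₂.hasDerivAt
  have e1 := DW_mul_deriv_WofProfile (r := r) hd₁ heq₁
  have e2 := DZ_mul_deriv_ZofProfile (r := r) hd₂ heq₂
  rw [hW.deriv] at e1
  rw [hZ.deriv] at e2
  have hf : field r (WofProfile 𝒲 ξ, ZofProfile 𝒲 ξ)
      = (deriv 𝒲 (Real.exp ξ) - WofProfile 𝒲 ξ, deriv 𝒲 (-Real.exp ξ) - ZofProfile 𝒲 ξ) := by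
    unfold field
    dsimp only
    refine Prod.ext ?_ ?_
    · show NW r (WofProfile 𝒲 ξ) (ZofProfile 𝒲 ξ) / DW (WofProfile 𝒲 ξ) (ZofProfile 𝒲 ξ) = _
      rw [div_eq_iff hDW, mul_comm]; exact e1.symm
    · show NZ r (WofProfile 𝒲 ξ) (ZofProfile 𝒲 ξ) / DZ (WofProfile 𝒲 ξ) (ZofProfile 𝒲 ξ) = _
      rw [div_eq_iff hDZ, mul_comm]; exact e2.symm
  rw [hf]
  exact hW.prodMk hZ

/-! ### Asymptotics as `ξ → −∞` -/

/-- `e^ξ → 0` within `{0}ᶜ` as `ξ → −∞`. [folklore] -/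
theorem tendsto_exp_atBot_nhdsNE : Tendsto Real.exp atBot (𝓝[≠] (0 : ℝ)) :=
  tendsto_nhdsWithin_iff.mpr ⟨Real.tendsto_exp_atBot, Eventually.of_forall fun ξ => (Real.exp_pos ξ).ne'⟩

/-- `−e^ξ → 0` within `{0}ᶜ` as `ξ → −∞`. [folklore] -/
theorem tendsto_neg_exp_atBot_nhdsNE : Tendsto (fun ξ => -Real.exp ξ) atBot (𝓝[≠] (0 : ℝ)) :=
  tendsto_nhdsWithin_iff.mpr ⟨by simpa using Real.tendsto_exp_atBot.neg,
    Eventually.of_forall fun ξ => neg_ne_zero.mpr (Real.exp_pos ξ).ne'⟩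

/-- `W(ξ) → +∞` as `ξ → −∞` when `𝒲` is continuous at `0` with `𝒲(0) > 0`.
[cite: BuckmasterCaolaboraGomezserrano2025, Prop. 2.5 (proof)] -/
theorem tendsto_WofProfile_atBot {𝒲 : ℝ → ℝ} (hc : ContinuousAt 𝒲 0) (h0 : 0 < 𝒲 0) :
    Tendsto (WofProfile 𝒲) atBot atTop := by
  have h1 : Tendsto (fun ξ => 𝒲 (Real.exp ξ)) atBot (𝓝 (𝒲 0)) :=
    hc.tendsto.comp Real.tendsto_exp_atBot
  have h2 : Tendsto (fun ξ : ℝ => Real.exp (-ξ)) atBot atTop :=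
    Real.tendsto_exp_atTop.comp tendsto_neg_atBot_atTop
  have := h1.pos_mul_atTop h0 h2
  refine this.congr fun ξ => ?_
  unfold WofProfile; ring

/-- `Z(ξ) → −∞` as `ξ → −∞` when `𝒲` is continuous at `0` with `𝒲(0) > 0`.
[cite: BuckmasterCaolaboraGomezserrano2025, Prop. 2.5 (proof)] -/
theorem tendsto_ZofProfile_atBot {𝒲 : ℝ → ℝ} (hc : ContinuousAt 𝒲 0) (h0 : 0 < 𝒲 0) :
    Tendsto (ZofProfile 𝒲) atBot atBot := by
  have h1 : Tendsto (fun ξ => 𝒲 (-Real.exp ξ)) atBot (𝓝 (𝒲 0)) :=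
    hc.tendsto.comp (by simpa using Real.tendsto_exp_atBot.neg)
  have h2 : Tendsto (fun ξ : ℝ => Real.exp (-ξ)) atBot atTop :=
    Real.tendsto_exp_atTop.comp tendsto_neg_atBot_atTop
  have h3 := h1.pos_mul_atTop h0 h2
  have h4 := tendsto_neg_atTop_atBot.comp h3
  refine h4.congr fun ξ => ?_
  simp only [Function.comp_apply]
  unfold ZofProfile; ring

/-- `W(ξ) + Z(ξ) → 2𝒲′(0)` as `ξ → −∞` ("`W + Z = 2w₁ + O(ζ)`").
[cite: BuckmasterCaolaboraGomezserrano2025, Prop. 2.5 (proof)] -/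
theorem tendsto_W_add_Z_atBot {𝒲 : ℝ → ℝ} {D : ℝ} (hD : HasDerivAt 𝒲 D 0) :
    Tendsto (fun ξ => WofProfile 𝒲 ξ + ZofProfile 𝒲 ξ) atBot (𝓝 (2 * D)) := by
  have hs : Tendsto (slope 𝒲 0) (𝓝[≠] 0) (𝓝 D) := hasDerivAt_iff_tendsto_slope.mp hD
  have h1 : Tendsto (fun ξ => slope 𝒲 0 (Real.exp ξ)) atBot (𝓝 D) := hs.comp tendsto_exp_atBot_nhdsNE
  have h2 : Tendsto (fun ξ => slope 𝒲 0 (-Real.exp ξ)) atBot (𝓝 D) :=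
    hs.comp tendsto_neg_exp_atBot_nhdsNE
  have h3 := h1.add h2
  rw [show D + D = 2 * D by ring] at h3
  refine h3.congr fun ξ => ?_
  rw [slope_def_field, slope_def_field]
  unfold WofProfile ZofProfile
  have hpos : Real.exp ξ ≠ 0 := (Real.exp_pos ξ).ne'
  rw [Real.exp_neg]
  field_simp
  ring

/-- `D_Z(W, Z)(ξ) → −∞` and `D_W(W, Z)(ξ) → +∞` as `ξ → −∞`.
[cite: BuckmasterCaolaboraGomezserrano2025, Prop. 2.5 (proof)] -/
theorem tendsto_DZ_DW_atBot {𝒲 : ℝ → ℝ} {D : ℝ} (hD : HasDerivAt 𝒲 D 0) (h0 : 0 < 𝒲 0) :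
    Tendsto (fun ξ => DZ (WofProfile 𝒲 ξ) (ZofProfile 𝒲 ξ)) atBot atBot ∧
    Tendsto (fun ξ => DW (WofProfile 𝒲 ξ) (ZofProfile 𝒲 ξ)) atBot atTop := by
  have hc : ContinuousAt 𝒲 0 := hD.continuousAt
  have hsum := tendsto_W_add_Z_atBot hD
  have hW := tendsto_WofProfile_atBot hc h0
  have hZ := tendsto_ZofProfile_atBot hc h0
  constructor
  · -- `D_Z = 1 + ((W + Z) + Z)/3`
    have h1 : Tendsto (fun ξ => (WofProfile 𝒲 ξ + ZofProfile 𝒲 ξ) + ZofProfile 𝒲 ξ) atBot atBot :=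
      hsum.add_atBot hZ
    have h2 : Tendsto (fun ξ => 1 + ((WofProfile 𝒲 ξ + ZofProfile 𝒲 ξ) + ZofProfile 𝒲 ξ) / 3)
        atBot atBot :=
      tendsto_atBot_add_const_left _ _ (h1.atBot_div_const (by norm_num))
    refine h2.congr fun ξ => ?_
    unfold DZ; ring
  · have h1 : Tendsto (fun ξ => (WofProfile 𝒲 ξ + ZofProfile 𝒲 ξ) + WofProfile 𝒲 ξ) atBot atTop :=
      hsum.add_atTop hW
    have h2 : Tendsto (fun ξ => 1 + ((WofProfile 𝒲 ξ + ZofProfile 𝒲 ξ) + WofProfile 𝒲 ξ) / 3)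
        atBot atTop :=
      tendsto_atTop_add_const_left _ _ (h1.atTop_div_const (by norm_num))
    refine h2.congr fun ξ => ?_
    unfold DW; ring

/-- **Entry into the triangle** (Prop. 2.5, second part, first step, `γ = 5/3`): for `1 < r < r*`
and a profile `𝒲` with `𝒲(0) > 0`, `𝒲′(0) = 1 − r`, the curve `(W, Z)(ξ)` is, for all `ξ` near
`−∞`, off both sonic lines (`D_W > 0 > D_Z`) and in the triangle `𝒯^{(H)}`, `H = W(ξ) − W₀`:
`W ≤ W₀ + H`, `(W − W₀) + (Z − Z₀) ≥ 0` (as `W + Z → 2(1 − r) > q − r = W₀ + Z₀`), `D_Z ≤ 0`.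
[cite: BuckmasterCaolaboraGomezserrano2025, Prop. 2.5 (proof)] -/
theorem eventually_entry (h1 : 1 < r) (hr : r < rstar) {𝒲 : ℝ → ℝ}
    (hD : HasDerivAt 𝒲 (1 - r) 0) (h0 : 0 < 𝒲 0) :
    ∀ᶠ ξ in atBot,
      0 < DW (WofProfile 𝒲 ξ) (ZofProfile 𝒲 ξ) ∧ DZ (WofProfile 𝒲 ξ) (ZofProfile 𝒲 ξ) < 0 ∧
      W0 r ≤ WofProfile 𝒲 ξ ∧
      0 ≤ (WofProfile 𝒲 ξ - W0 r) + (ZofProfile 𝒲 ξ - Z0 r) := by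
  obtain ⟨hDZ, hDW⟩ := tendsto_DZ_DW_atBot hD h0
  have hsum := tendsto_W_add_Z_atBot hD
  have hW := tendsto_WofProfile_atBot hD.continuousAt h0
  -- `q < 2 - r`, i.e. `W₀ + Z₀ = q - r < 2(1 - r)`
  have hq : q r < 2 - r := by
    have hq2 := q_sq (disc_pos hr).le
    have hq0 := q_nonneg r
    have hr2 : r < 2 := by linarith [rstar_lt]
    nlinarith
  have hgap : W0 r + Z0 r < 2 * (1 - r) := by unfold W0 Z0; linarith
  have e1 : ∀ᶠ ξ in atBot, 0 < DW (WofProfile 𝒲 ξ) (ZofProfile 𝒲 ξ) := hDW.eventually_gt_atTop 0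
  have e2 : ∀ᶠ ξ in atBot, DZ (WofProfile 𝒲 ξ) (ZofProfile 𝒲 ξ) < 0 := hDZ.eventually_lt_atBot 0
  have e3 : ∀ᶠ ξ in atBot, W0 r ≤ WofProfile 𝒲 ξ := hW.eventually_ge_atTop _
  have e4 : ∀ᶠ ξ in atBot, W0 r + Z0 r < WofProfile 𝒲 ξ + ZofProfile 𝒲 ξ :=
    hsum.eventually_const_lt hgap
  filter_upwards [e1, e2, e3, e4] with ξ k1 k2 k3 k4
  exact ⟨k1, k2, k3, by linarith⟩

end Monatomic

end BuckmasterCaolaboraGomezserrano2025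

end Literature.Analysis.FluidPDE
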